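import Summits.AtomisticToContinuum.Crystallization.Theorems.FrustratedLawDichotomyTextureCoarseTransfer
import Summits.AtomisticToContinuum.Crystallization.Theorems.FrustratedLawDichotomyTextureUniformVerdict

/-!
# FrustratedLawDichotomy · crux `AperiodicFrustratedLawGap` (stmt-AtomisticToContinuum-27623) — (FLIP), GOOD verdict: a coherent window over a
# good-with-margin template makes the matched textured sites `1/8`-GOOD (decomp-a2c lens-5 g111; critic r1702 (B)(3)(b), r1712 (C5), r1713 (D))

Layer (FLIP) of `not_coherent_of_texBall` = (UV) ∘ (FLIP) ((UV) = `…TextureUniformVerdict`, the logic to `htex` = `…TextureIncoherence`), GOOD half,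
at SET level and in the `hflip` shape of `…TextureIncoherence.exists_incoherent_atom_of_apprM` with `R' := 0` (only the ROOT's coherent window is
used), proved by the TREE engines with the explicit constants of the collar table (`c_tol = 4`, `c_gap = 46/10`; memo decomp-a2c-lens-5/g111 §2).
Companion files: `…TextureFlipBad` (BAD verdict), `…TextureFlipRoot` (root-only `1/20` kill for near-perfect hosts, no `R₈/R₉`-dependence).

* ★ `robustGood_of_template` — deterministic, SET level.  INPUT: a `τ`-COHERENT WINDOW of the atom set `S` over a finite template `a`
  («every template ball `closedBall x τ`, `x ∈ a`, holds exactly one atom; every atom of `S` in `closedBall 0 Rc` lies in a template ball» — the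
  configuration reading of `…CoherentSets.coherentAt` + hard core: `hC1`, `hC1'`, `hC2`), an atom `p` in the ball of the template site `x₀`, and `x₀`
  GOOD WITH MARGIN in the template for a kissing pattern `Pat` (scale `d₀`, tolerance `η₀`, isometry `A`, shell map `t₀`, shell gap `γ₀`, exact
  nearest neighbour; margins `η₀ d₀ + 4τ < θ(d₀ − 2τ)` for a verdict level `0 < θ ≤ 1/8`, and `46/10·τ < γ₀`; window `‖x₀‖ + 13/10·d₀ + γ₀ + 4τ ≤ Rc`).
  OUTPUT: `p` is ROBUSTLY `η`-GOOD in `S` with `η < θ` — literally the seven-clause package the engines `good_transfer_core_eighth` (`θ = 1/8`) /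
  `good_transfer_core` (`θ = 1/20`) consume — at the attained nearest-neighbour scale `d ∈ [d₀ − 2τ, d₀ + 2τ]`, `η d = η₀ d₀ + 4τ`, gap `γ = γ₀ − 46/10·τ`,
  same isometry `A`, shell map `t u :=` the unique atom of the ball of `t₀ u`.
* ★ `gy_eighth_of_template_matched` — composite with the TREE engines `matching_recentre` and `good_transfer_core_eighth`: a `7/10`-separated finite
  configuration `y` two-way `ε`-matched to `S` around `(y i, p)` and a site `j` within `ρ` of `y i` matched to an atom whose template site is good
  with margin (`θ = 1/8`) is `1/8`-GOOD, `Gy (1/8) N y j`, under the engine numerics at tolerance `2ε`.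
* ★ `forall_gy_eighth_of_uniformGoodTemplate` — the GOOD verdict on the whole `ρ`-ball about `y i` from a UNIFORMLY good-with-margin template (every
  site within `‖p‖ + ρ + ε + τ` of the origin good with margin): literally the first disjunct of `hflip`'s conclusion.
[folklore] throughout; no definitions, no `sorry`, no instances, no notation.
-/

noncomputable section

namespace Summit.AtomisticToContinuum.Crystallization.Theorems.FrustratedLawDichotomyTextureFlipGood

open Metric Set
open Literature.Geometry.DiscreteGeometry
open Summit.AtomisticToContinuum.Crystallization.Theorems.RepetitiveNetworkReductionRecurrentMember (Gy TexBall ApprM)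
open Summit.AtomisticToContinuum.Crystallization.Theorems.FrustratedLawDichotomyTextureCoarseCore (good_transfer_core_eighth)
open Summit.AtomisticToContinuum.Crystallization.Theorems.FrustratedLawDichotomyTextureCoarseTransfer (matching_recentre)

/-- ★ **COHERENT WINDOW OVER A GOOD-WITH-MARGIN TEMPLATE ⟹ ROBUSTLY GOOD ATOM.**  See the module docstring; the output is the seven-clause
robust-goodness package of the tree engines, with `d₀ − 2τ ≤ d ≤ d₀ + 2τ`, `η·d = η₀ d₀ + 4τ`, `γ = γ₀ − 46/10·τ`. [folklore] -/
theorem robustGood_of_template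
    {S : Set (EuclideanSpace ℝ (Fin 3))} {a : Finset (EuclideanSpace ℝ (Fin 3))} {τ Rc : ℝ} {x₀ p : EuclideanSpace ℝ (Fin 3)}
    (hτ : 0 ≤ τ)
    (hC1 : ∀ x ∈ a, ∃ s, s ∈ closedBall x τ ∩ S)
    (hC1' : ∀ x ∈ a, (closedBall x τ ∩ S).Subsingleton)
    (hC2 : ∀ s ∈ S, s ∈ closedBall (0 : EuclideanSpace ℝ (Fin 3)) Rc → ∃ x ∈ a, s ∈ closedBall x τ)
    (hx₀ : x₀ ∈ a) (hp : p ∈ closedBall x₀ τ ∩ S)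
    {Pat : Finset (EuclideanSpace ℝ (Fin 3))} (hPat : Pat.Nonempty) (hPatn : ∀ u ∈ Pat, ‖u‖ = 1)
    {d₀ η₀ γ₀ : ℝ} {A : EuclideanSpace ℝ (Fin 3) →ₗᵢ[ℝ] EuclideanSpace ℝ (Fin 3)} {t₀ : ↥Pat → EuclideanSpace ℝ (Fin 3)}
    (hd₀ : 0 < d₀) (hη₀ : 0 ≤ η₀)
    (ht₀ : ∀ u : ↥Pat, t₀ u ∈ a ∧ ‖(t₀ u - x₀) - d₀ • A (u : EuclideanSpace ℝ (Fin 3))‖ ≤ η₀ * d₀)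
    (hnn₀ : ∀ z ∈ a, z ≠ x₀ → d₀ ≤ dist z x₀) (hnn₀' : ∃ z ∈ a, z ≠ x₀ ∧ dist z x₀ ≤ d₀)
    (hgap₀ : ∀ z ∈ a, z ≠ x₀ → dist z x₀ < 13 / 10 * d₀ + γ₀ → dist z x₀ ≤ 13 / 10 * d₀ - γ₀ ∧ z ∈ Set.range t₀)
    {θ : ℝ} (hθ0 : 0 < θ) (hθ : θ ≤ 1 / 8) (hmarg₁ : η₀ * d₀ + 4 * τ < θ * (d₀ - 2 * τ)) (hmarg₂ : 46 / 10 * τ < γ₀)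
    (hRc : ‖x₀‖ + 13 / 10 * d₀ + γ₀ + 4 * τ ≤ Rc) :
    ∃ (d η γ : ℝ) (t : ↥Pat → EuclideanSpace ℝ (Fin 3)),
      d₀ - 2 * τ ≤ d ∧ d ≤ d₀ + 2 * τ ∧ η * d = η₀ * d₀ + 4 * τ ∧ γ = γ₀ - 46 / 10 * τ ∧
      0 < d ∧ 0 < γ ∧ η < θ ∧
      (∀ u : ↥Pat, t u ∈ S ∧ ‖(t u - p) - d • A (u : EuclideanSpace ℝ (Fin 3))‖ ≤ η * d) ∧
      (∀ s : EuclideanSpace ℝ (Fin 3), s ∈ S → s ≠ p → d ≤ dist s p) ∧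
      (∃ s : EuclideanSpace ℝ (Fin 3), s ∈ S ∧ s ≠ p ∧ dist s p ≤ d) ∧
      (∀ s : EuclideanSpace ℝ (Fin 3), s ∈ S → s ≠ p → dist s p < 13 / 10 * d + γ →
        dist s p ≤ 13 / 10 * d - γ ∧ s ∈ Set.range t) := by
  classical
  have hmarg₁' : η₀ * d₀ + 4 * τ < 1 / 8 * (d₀ - 2 * τ) := by
    have hd₀τ' : 2 * τ < d₀ := by
      by_contra h
      have h1 : θ * (d₀ - 2 * τ) ≤ 0 := mul_nonpos_of_nonneg_of_nonpos hθ0.le (by linarith)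
      have h2 : 0 ≤ η₀ * d₀ := mul_nonneg hη₀ hd₀.le
      linarith
    have h1 : θ * (d₀ - 2 * τ) ≤ 1 / 8 * (d₀ - 2 * τ) := mul_le_mul_of_nonneg_right hθ (by linarith)
    linarith
  -- the shell map: the unique atom of each shell ball
  choose t ht using fun u : ↥Pat => hC1 (t₀ u) (ht₀ u).1
  obtain ⟨u₀, hu₀⟩ := hPat
  have hne : (Finset.univ : Finset ↥Pat).Nonempty := ⟨⟨u₀, hu₀⟩, Finset.mem_univ _⟩
  obtain ⟨um, -, hum⟩ := Finset.exists_mem_eq_inf' hne (fun u : ↥Pat => dist (t u) p)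
  set d : ℝ := Finset.univ.inf' hne (fun u : ↥Pat => dist (t u) p) with hd_def
  have hdle : ∀ u : ↥Pat, d ≤ dist (t u) p := fun u => Finset.inf'_le _ (Finset.mem_univ u)
  -- elementary distances
  have hpx : dist p x₀ ≤ τ := mem_closedBall.mp hp.1
  have htu : ∀ u : ↥Pat, dist (t u) (t₀ u) ≤ τ := fun u => mem_closedBall.mp (ht u).1
  have hAu : ∀ u : ↥Pat, ‖A (u : EuclideanSpace ℝ (Fin 3))‖ = 1 := fun u => by
    rw [LinearIsometry.norm_map]; exact hPatn u u.2
  have hη₀d : 0 ≤ η₀ * d₀ := mul_nonneg hη₀ hd₀.le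
  have hd₀τ : 2 * τ < d₀ := by linarith
  have ht₀far : ∀ u : ↥Pat, d₀ * (1 - η₀) ≤ dist (t₀ u) x₀ := by
    intro u
    have h1 := (ht₀ u).2
    have h2 : ‖d₀ • A (u : EuclideanSpace ℝ (Fin 3))‖ = d₀ := by
      rw [norm_smul, hAu, mul_one, Real.norm_eq_abs, abs_of_pos hd₀]
    have h3 : ‖d₀ • A (u : EuclideanSpace ℝ (Fin 3))‖ ≤ ‖t₀ u - x₀‖ + ‖(t₀ u - x₀) - d₀ • A (u : EuclideanSpace ℝ (Fin 3))‖ := by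
      have := norm_sub_le (t₀ u - x₀) ((t₀ u - x₀) - d₀ • A (u : EuclideanSpace ℝ (Fin 3)))
      rwa [sub_sub_cancel] at this
    rw [dist_eq_norm]
    nlinarith
  have ht₀ne : ∀ u : ↥Pat, t₀ u ≠ x₀ := by
    intro u h
    have h1 := ht₀far u
    rw [h, dist_self] at h1
    have h2 : η₀ < 1 := by nlinarith
    nlinarith
  have ht₀ge : ∀ u : ↥Pat, d₀ ≤ dist (t₀ u) x₀ := fun u => hnn₀ _ (ht₀ u).1 (ht₀ne u)
  have htp_ge : ∀ u : ↥Pat, d₀ - 2 * τ ≤ dist (t u) p := by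
    intro u
    have := dist_triangle4 (t₀ u) (t u) p x₀
    rw [dist_comm (t₀ u) (t u)] at this
    linarith [ht₀ge u, htu u]
  have hd_ge : d₀ - 2 * τ ≤ d := by rw [hum]; exact htp_ge um
  have hd_pos : 0 < d := by linarith
  have hd_le : d ≤ d₀ + 2 * τ := by
    obtain ⟨z₁, hz₁, hz₁ne, hz₁d⟩ := hnn₀'
    have hlt : dist z₁ x₀ < 13 / 10 * d₀ + γ₀ := by linarith
    obtain ⟨-, ⟨u₁, hu₁⟩⟩ := hgap₀ z₁ hz₁ hz₁ne hlt
    rw [← hu₁] at hz₁d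
    have h1 := hdle u₁
    have h2 := dist_triangle4 (t u₁) (t₀ u₁) x₀ p
    have h3 : dist x₀ p ≤ τ := by rw [dist_comm]; exact hpx
    linarith [htu u₁]
  -- uniqueness and the window
  have huniq : ∀ x ∈ a, ∀ s ∈ closedBall x τ ∩ S, ∀ s' ∈ closedBall x τ ∩ S, s = s' :=
    fun x hx s hs s' hs' => hC1' x hx hs hs'
  -- the key identification: atoms near `p` are shell atoms `t u` over template shell sites
  have hshell : ∀ s ∈ S, s ≠ p → dist s p < 13 / 10 * d + (γ₀ - 46 / 10 * τ) →
      ∃ u : ↥Pat, s = t u ∧ dist (t₀ u) x₀ ≤ 13 / 10 * d₀ - γ₀ := by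
    intro s hs hsp hlt
    have hwin : s ∈ closedBall (0 : EuclideanSpace ℝ (Fin 3)) Rc := by
      rw [mem_closedBall]
      have h1 := dist_triangle4 s p x₀ (0 : EuclideanSpace ℝ (Fin 3))
      have h2 : dist x₀ (0 : EuclideanSpace ℝ (Fin 3)) = ‖x₀‖ := dist_zero_right x₀
      linarith
    obtain ⟨z, hz, hsz⟩ := hC2 s hs hwin
    have hzne : z ≠ x₀ := by
      rintro rfl
      exact hsp (huniq z hz s ⟨hsz, hs⟩ p hp)
    have hzx : dist z x₀ < 13 / 10 * d₀ + γ₀ := by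
      have h1 := dist_triangle4 z s p x₀
      have h2 : dist z s ≤ τ := by rw [dist_comm]; exact mem_closedBall.mp hsz
      linarith
    obtain ⟨hzle, ⟨u, hu⟩⟩ := hgap₀ z hz hzne hzx
    refine ⟨u, huniq z hz s ⟨hsz, hs⟩ (t u) ⟨?_, (ht u).2⟩, by rw [hu]; exact hzle⟩
    rw [← hu]; exact (ht u).1
  -- the package
  refine ⟨d, (η₀ * d₀ + 4 * τ) / d, γ₀ - 46 / 10 * τ, t, hd_ge, hd_le, div_mul_cancel₀ _ hd_pos.ne', rfl, hd_pos,
    by linarith, ?_, ?_, ?_, ?_, ?_⟩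
  · rw [div_lt_iff₀ hd_pos]
    have h1 : θ * (d₀ - 2 * τ) ≤ θ * d := mul_le_mul_of_nonneg_left hd_ge hθ0.le
    linarith
  · intro u
    refine ⟨(ht u).2, ?_⟩
    have hsplit : (t u - p) - d • A (u : EuclideanSpace ℝ (Fin 3)) =
        ((t₀ u - x₀) - d₀ • A (u : EuclideanSpace ℝ (Fin 3))) + ((t u - t₀ u) + (x₀ - p)) +
          (d₀ - d) • A (u : EuclideanSpace ℝ (Fin 3)) := by
      rw [sub_smul]; abel
    have h1 : ‖(t u - t₀ u) + (x₀ - p)‖ ≤ τ + τ := by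
      refine (norm_add_le _ _).trans (add_le_add ?_ ?_)
      · rw [← dist_eq_norm]; exact htu u
      · rw [← dist_eq_norm, dist_comm]; exact hpx
    have h2 : ‖(d₀ - d) • A (u : EuclideanSpace ℝ (Fin 3))‖ ≤ 2 * τ := by
      rw [norm_smul, hAu, mul_one, Real.norm_eq_abs]
      exact abs_le.mpr ⟨by linarith, by linarith⟩
    calc ‖(t u - p) - d • A (u : EuclideanSpace ℝ (Fin 3))‖
        ≤ ‖(t₀ u - x₀) - d₀ • A (u : EuclideanSpace ℝ (Fin 3))‖ + ‖(t u - t₀ u) + (x₀ - p)‖ +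
            ‖(d₀ - d) • A (u : EuclideanSpace ℝ (Fin 3))‖ := by
          rw [hsplit]; exact (norm_add_le _ _).trans (add_le_add (norm_add_le _ _) le_rfl)
      _ ≤ η₀ * d₀ + (τ + τ) + 2 * τ := add_le_add (add_le_add (ht₀ u).2 h1) h2
      _ = (η₀ * d₀ + 4 * τ) / d * d := by rw [div_mul_cancel₀ _ hd_pos.ne']; ring
  · intro s hs hsp
    by_contra hle
    have hlt : dist s p < d := lt_of_not_ge hle
    have hlt' : dist s p < 13 / 10 * d + (γ₀ - 46 / 10 * τ) := by linarith
    obtain ⟨u, hsu, -⟩ := hshell s hs hsp hlt'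
    have := hdle u
    rw [← hsu] at this
    linarith
  · refine ⟨t um, (ht um).2, ?_, le_of_eq hum.symm⟩
    intro h
    have h1 : dist (t₀ um) x₀ ≤ τ + τ := by
      have h2 := dist_triangle (t₀ um) p x₀
      have h3 : dist (t₀ um) p ≤ τ := by rw [← h, dist_comm]; exact htu um
      linarith
    linarith [ht₀ge um]
  · intro s hs hsp hlt
    obtain ⟨u, hsu, hux⟩ := hshell s hs hsp hlt
    refine ⟨?_, ⟨u, hsu.symm⟩⟩
    have h1 := dist_triangle4 s (t₀ u) x₀ p
    have h2 : dist s (t₀ u) ≤ τ := by rw [hsu]; exact htu u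
    rw [dist_comm] at hpx
    linarith

/-- ★ **(FLIP), GOOD direction, composite with the tree engines.**  A `7/10`-separated finite configuration `y`, two-way `ε`-matched to the
`δ`-separated atom set `S` around `(y i, p)` up to radius `R`, a site `j` within `ρ` of `y i` matched to the atom `p₁ ∈ S`, and a `τ`-coherent
window of `S` over a template `a` in which the site `x₁ ∋ p₁` is GOOD WITH MARGIN for the fcc or the hcp kissing pattern: then `y j` is
`1/8`-GOOD, `Gy (1/8) N y j`.  Engine numerics at tolerance `2ε` (after re-centring): `80ε ≤ d₀ − 34τ − 8η₀d₀`, `10ε ≤ γ₀ − 46/10·τ`, `8ε < δ`,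
`8ε < 7/10`, `2d₀ + γ₀ + 2 ≤ R − ρ − ε`.  (`robustGood_of_template` + `matching_recentre` + `good_transfer_core_eighth`.) [folklore] -/
theorem gy_eighth_of_template_matched
    {S : Set (EuclideanSpace ℝ (Fin 3))} {δ : ℝ} (hS : ∀ x ∈ S, ∀ x' ∈ S, x ≠ x' → δ ≤ dist x x')
    {a : Finset (EuclideanSpace ℝ (Fin 3))} {τ Rc : ℝ} (hτ : 0 ≤ τ)
    (hC1 : ∀ x ∈ a, ∃ s, s ∈ closedBall x τ ∩ S)
    (hC1' : ∀ x ∈ a, (closedBall x τ ∩ S).Subsingleton)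
    (hC2 : ∀ s ∈ S, s ∈ closedBall (0 : EuclideanSpace ℝ (Fin 3)) Rc → ∃ x ∈ a, s ∈ closedBall x τ)
    {N : ℕ} {y : Fin N → EuclideanSpace ℝ (Fin 3)} {i j : Fin N} {p p₁ x₁ : EuclideanSpace ℝ (Fin 3)} {R ρ ε : ℝ}
    (hsepY : ∀ a b : Fin N, a ≠ b → (7 : ℝ) / 10 ≤ dist (y a) (y b))
    (hm1 : ∀ s ∈ S, dist s p ≤ R → ∃ b : Fin N, dist (y b - y i) (s - p) ≤ ε)
    (hm2 : ∀ b : Fin N, dist (y b) (y i) ≤ R → ∃ s ∈ S, dist (y b - y i) (s - p) ≤ ε)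
    (hp₁ : p₁ ∈ S) (hj : dist (y j - y i) (p₁ - p) ≤ ε) (hjρ : dist (y j) (y i) ≤ ρ)
    (hx₁ : x₁ ∈ a) (hp₁x : p₁ ∈ closedBall x₁ τ)
    {Pat : Finset (EuclideanSpace ℝ (Fin 3))} (hwhich : Pat = fccKissingPattern ∨ Pat = hcpKissingPattern)
    {d₀ η₀ γ₀ : ℝ} {A : EuclideanSpace ℝ (Fin 3) →ₗᵢ[ℝ] EuclideanSpace ℝ (Fin 3)} {t₀ : ↥Pat → EuclideanSpace ℝ (Fin 3)}
    (hd₀ : 0 < d₀) (hη₀ : 0 ≤ η₀)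
    (ht₀ : ∀ u : ↥Pat, t₀ u ∈ a ∧ ‖(t₀ u - x₁) - d₀ • A (u : EuclideanSpace ℝ (Fin 3))‖ ≤ η₀ * d₀)
    (hnn₀ : ∀ z ∈ a, z ≠ x₁ → d₀ ≤ dist z x₁) (hnn₀' : ∃ z ∈ a, z ≠ x₁ ∧ dist z x₁ ≤ d₀)
    (hgap₀ : ∀ z ∈ a, z ≠ x₁ → dist z x₁ < 13 / 10 * d₀ + γ₀ → dist z x₁ ≤ 13 / 10 * d₀ - γ₀ ∧ z ∈ Set.range t₀)
    (hmarg₁ : η₀ * d₀ + 4 * τ < 1 / 8 * (d₀ - 2 * τ)) (hmarg₂ : 46 / 10 * τ < γ₀)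
    (hRc : ‖x₁‖ + 13 / 10 * d₀ + γ₀ + 4 * τ ≤ Rc)
    (hε0 : 0 < ε) (hεη : 80 * ε ≤ d₀ - 34 * τ - 8 * (η₀ * d₀)) (hεγ : 10 * ε ≤ γ₀ - 46 / 10 * τ)
    (hεδ : 8 * ε < δ) (hε7 : 8 * ε < 7 / 10) (hR : 2 * d₀ + γ₀ + 2 ≤ R - ρ - ε) :
    Gy (1 / 8) N y j := by
  have hPat : Pat.Nonempty := by
    rcases hwhich with rfl | rfl
    · exact FrustratedLawDichotomyTextureFineShells.fccKissingPattern_nonempty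
    · exact FrustratedLawDichotomyTextureFineShells.hcpKissingPattern_nonempty
  have hPatn : ∀ u ∈ Pat, ‖u‖ = 1 := by
    rcases hwhich with rfl | rfl
    · exact fun u hu => norm_eq_one_of_mem_fccKissingPattern hu
    · exact fun u hu => norm_eq_one_of_mem_hcpKissingPattern hu
  have hPat1 : ∀ u ∈ Pat, ∀ u' ∈ Pat, u ≠ u' → 1 ≤ dist u u' := by
    rcases hwhich with rfl | rfl
    · exact fun u hu u' hu' hne => one_le_dist_of_mem_fccKissingPattern hu hu' hne
    · exact fun u hu u' hu' hne => one_le_dist_of_mem_hcpKissingPattern hu hu' hne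
  obtain ⟨d, η, γ, t, hd_ge, hd_le, hηd, hγ, hd, hγ0, hη, ht, hnn₁, hnn₂, hgap⟩ :=
    robustGood_of_template hτ hC1 hC1' hC2 hx₁ ⟨hp₁x, hp₁⟩ hPat hPatn hd₀ hη₀ ht₀ hnn₀ hnn₀' hgap₀ (by norm_num) le_rfl hmarg₁ hmarg₂ hRc
  obtain ⟨hm1', hm2'⟩ := matching_recentre hm1 hm2 hj hjρ hε0.le
  have hjj : dist (y j - y j) (p₁ - p₁) ≤ 2 * ε := by
    rw [sub_self, sub_self, dist_self]; linarith
  have hnn₂' : ∃ s ∈ S, s ≠ p₁ ∧ dist s p₁ ≤ d := by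
    obtain ⟨s, hs, h1, h2⟩ := hnn₂
    exact ⟨s, hs, h1, h2⟩
  have hεη' : 40 * (2 * ε) ≤ d * (1 - 8 * η) := by
    have : d * (1 - 8 * η) = d - 8 * (η * d) := by ring
    rw [this, hηd]; linarith
  obtain ⟨e, he⟩ := good_transfer_core_eighth hS hsepY hm1' hm2' hp₁ hjj hPat hPatn hPat1 hd hη ht
    (fun s hs hsp => hnn₁ s hs hsp) hnn₂' (fun s hs hsp => hgap s hs hsp)
    (by linarith) hεη' (by rw [hγ]; linarith) (by linarith) (by linarith) (by rw [hγ]; linarith) rfl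
  dsimp only [Gy]
  rcases hwhich with rfl | rfl
  · exact ⟨A, Or.inl ⟨e, he⟩⟩
  · exact ⟨A, Or.inr ⟨e, he⟩⟩

/-- ★ **(FLIP), GOOD verdict on the whole `ρ`-ball — the `hflip` shape of `…TextureIncoherence` with `R' := 0`.**  If the atom set `S` is
`τ`-coherent over the template `a` on the window `closedBall 0 Rc`, the matching centre `p ∈ S` satisfies `‖p‖ + ρ + ε ≤ Rc`, and EVERY template
site `x` with `‖x‖ ≤ ‖p‖ + ρ + ε + τ` is good with margin for the pattern `Pat` (fcc or hcp) with site constants resolving `ε` and `R`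
(`80ε ≤ d₀ − 34τ − 8η₀d₀`, `10ε ≤ γ₀ − 46/10·τ`, `2d₀ + γ₀ + 2 ≤ R − ρ − ε`, window `‖x‖ + 13/10·d₀ + γ₀ + 4τ ≤ Rc`), then EVERY site of a
`7/10`-separated configuration `y` two-way `ε`-matched to `S` around `(y i, p)` up to radius `R ≥ ρ` that lies within `ρ` of `y i` is `1/8`-GOOD.
[folklore] -/
theorem forall_gy_eighth_of_uniformGoodTemplate
    {S : Set (EuclideanSpace ℝ (Fin 3))} {δ : ℝ} (hS : ∀ x ∈ S, ∀ x' ∈ S, x ≠ x' → δ ≤ dist x x')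
    {a : Finset (EuclideanSpace ℝ (Fin 3))} {τ Rc : ℝ} (hτ : 0 ≤ τ)
    (hC1 : ∀ x ∈ a, ∃ s, s ∈ closedBall x τ ∩ S)
    (hC1' : ∀ x ∈ a, (closedBall x τ ∩ S).Subsingleton)
    (hC2 : ∀ s ∈ S, s ∈ closedBall (0 : EuclideanSpace ℝ (Fin 3)) Rc → ∃ x ∈ a, s ∈ closedBall x τ)
    {N : ℕ} {y : Fin N → EuclideanSpace ℝ (Fin 3)} {i : Fin N} {p : EuclideanSpace ℝ (Fin 3)} {R ρ ε : ℝ}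
    (hsepY : ∀ a b : Fin N, a ≠ b → (7 : ℝ) / 10 ≤ dist (y a) (y b))
    (hm1 : ∀ s ∈ S, dist s p ≤ R → ∃ b : Fin N, dist (y b - y i) (s - p) ≤ ε)
    (hm2 : ∀ b : Fin N, dist (y b) (y i) ≤ R → ∃ s ∈ S, dist (y b - y i) (s - p) ≤ ε)
    (hρR : ρ ≤ R) (hρRc : ‖p‖ + ρ + ε ≤ Rc)
    {Pat : Finset (EuclideanSpace ℝ (Fin 3))} (hwhich : Pat = fccKissingPattern ∨ Pat = hcpKissingPattern)
    (hε0 : 0 < ε) (hεδ : 8 * ε < δ) (hε7 : 8 * ε < 7 / 10)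
    (hgood : ∀ x ∈ a, ‖x‖ ≤ ‖p‖ + ρ + ε + τ →
      ∃ (d₀ η₀ γ₀ : ℝ) (A : EuclideanSpace ℝ (Fin 3) →ₗᵢ[ℝ] EuclideanSpace ℝ (Fin 3)) (t₀ : ↥Pat → EuclideanSpace ℝ (Fin 3)),
        0 < d₀ ∧ 0 ≤ η₀ ∧
        (∀ u : ↥Pat, t₀ u ∈ a ∧ ‖(t₀ u - x) - d₀ • A (u : EuclideanSpace ℝ (Fin 3))‖ ≤ η₀ * d₀) ∧
        (∀ z ∈ a, z ≠ x → d₀ ≤ dist z x) ∧ (∃ z ∈ a, z ≠ x ∧ dist z x ≤ d₀) ∧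
        (∀ z ∈ a, z ≠ x → dist z x < 13 / 10 * d₀ + γ₀ → dist z x ≤ 13 / 10 * d₀ - γ₀ ∧ z ∈ Set.range t₀) ∧
        η₀ * d₀ + 4 * τ < 1 / 8 * (d₀ - 2 * τ) ∧ 46 / 10 * τ < γ₀ ∧ ‖x‖ + 13 / 10 * d₀ + γ₀ + 4 * τ ≤ Rc ∧
        80 * ε ≤ d₀ - 34 * τ - 8 * (η₀ * d₀) ∧ 10 * ε ≤ γ₀ - 46 / 10 * τ ∧ 2 * d₀ + γ₀ + 2 ≤ R - ρ - ε) :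
    ∀ j : Fin N, dist (y j) (y i) ≤ ρ → Gy (1 / 8) N y j := by
  intro j hjρ
  obtain ⟨p₁, hp₁, hj⟩ := hm2 j (hjρ.trans hρR)
  have hp₁p : dist p₁ p ≤ ρ + ε := by
    have h1 : ‖(p₁ - p) - (y j - y i)‖ ≤ ε := by rw [← dist_eq_norm, dist_comm]; exact hj
    calc dist p₁ p = ‖(y j - y i) + ((p₁ - p) - (y j - y i))‖ := by rw [dist_eq_norm]; congr 1; abel
      _ ≤ ‖y j - y i‖ + ‖(p₁ - p) - (y j - y i)‖ := norm_add_le _ _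
      _ ≤ ρ + ε := add_le_add (by rw [← dist_eq_norm]; exact hjρ) h1
  have hp₁win : p₁ ∈ closedBall (0 : EuclideanSpace ℝ (Fin 3)) Rc := by
    rw [mem_closedBall, dist_zero_right]
    have h1 : ‖p₁‖ ≤ ‖p‖ + dist p₁ p := by
      have := norm_add_le p (p₁ - p)
      rwa [add_sub_cancel, ← dist_eq_norm] at this
    linarith
  obtain ⟨x₁, hx₁, hp₁x⟩ := hC2 p₁ hp₁ hp₁win
  have hx₁n : ‖x₁‖ ≤ ‖p‖ + ρ + ε + τ := by
    have h1 : dist p₁ x₁ ≤ τ := mem_closedBall.mp hp₁x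
    have h2 : ‖x₁‖ ≤ ‖p₁‖ + dist p₁ x₁ := by
      have := norm_sub_le p₁ (p₁ - x₁)
      rwa [sub_sub_cancel, ← dist_eq_norm] at this
    have h3 : ‖p₁‖ ≤ ‖p‖ + dist p₁ p := by
      have := norm_add_le p (p₁ - p)
      rwa [add_sub_cancel, ← dist_eq_norm] at this
    linarith
  obtain ⟨d₀, η₀, γ₀, A, t₀, hd₀, hη₀, ht₀, hnn₀, hnn₀', hgap₀, hmarg₁, hmarg₂, hRc, hεη, hεγ, hR⟩ := hgood x₁ hx₁ hx₁n
  exact gy_eighth_of_template_matched hS hτ hC1 hC1' hC2 hsepY hm1 hm2 hp₁ hj hjρ hx₁ hp₁x hwhich hd₀ hη₀ ht₀ hnn₀ hnn₀'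
    hgap₀ hmarg₁ hmarg₂ hRc hε0 hεη hεγ hεδ hε7 hR

end Summit.AtomisticToContinuum.Crystallization.Theorems.FrustratedLawDichotomyTextureFlipGood

end
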